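import Literature.MathematicalPhysics.QuantumFieldTheory.Balaban1983to89.B9Local342OfEBlockInv
import Literature.MathematicalPhysics.QuantumFieldTheory.Balaban1983to89.B9Local342GOfEBlockInvB
import Literature.MathematicalPhysics.QuantumFieldTheory.Balaban1983to89.B9Thm310Whole
import Literature.MathematicalPhysics.QuantumFieldTheory.Balaban1983to89.B9WalkLettersOps

/-!
# `Balaban1983to89.B9Local342AtPins` — T. Bałaban, *Propagators for lattice gauge theories in a background field*, Commun. Math. Phys. **99** (1985) 389–434
# [Balaban1985BackgroundPropagators], Cor. 3.6 p. 408 + p. 409 («the operators G′_□(U) … satisfy all the inequalities of Theorems 3.1–3.3») with (3.42) p. 397: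
# THE `Local342` ∕ `Local342G` RECORDS OF THE WALK EXPANSIONS, KNIT AT THE PINS — for ANY letter record `𝔬` whose blocks and `G′_□ ∕ ∇_U ∕ ∇*_U ∕ Δ_U` fields are
# pinned to def-Y's coordinate models (`GcoS ∕ DcoS ∕ DscoS ∕ LcoS` over `blkSK (sIK bI)`, site sector; `GcoK ∕ DcoK ∕ DscoK ∕ LcoK` over `blkBK bI`, bond sector), the
# per-cube (3.42) block table over the gauge-invariant test class (`EBlock (kernelFamilySInv … (O □) …)` ∕ `EBlock (kernelFamilyBInv … (O □) …)`, one pair `(B₀, δ)`)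
# IS the record `B9Thm37Whole.Local342 𝔬` ∕ `B9Thm310Whole.Local342G 𝔬` with constant `c_R·c_b·b_b·B₀`; and the instance at dag-n06-d's record `opsWalkY` (rows 18)

statement-level skeleton of published theorems with citation tags; proofs where landed; nothing here is a claim about the Yang–Mills mass gap

**Sources.** B9 = [Balaban1985BackgroundPropagators] T. Bałaban, CMP **99** (1985) 389–434, Thm 3.1 (3.42) p. 397, Thm 3.3 p. 399, Cor. 3.6 p. 408, (3.87)–(3.90)
pp. 408–409, Thm 3.10 p. 416; [4] = [Balaban1984PropagatorsII] T. Bałaban, CMP **96** (1984) 223–250, (2.36)–(2.44) pp. 229–230, (2.51) p. 232.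

**The print.** p. 409: *"The operators constructed for this sequence, which we denote by G′_□(U), … satisfy all the inequalities of Theorems 3.1–3.3"*;
p. 416 (Thm 3.10): the same for the operators `G_□(U)` of the bond-sector expansion (3.107); (3.42) p. 397: *"|(G′(U)λ)(x)|, |(∇_UG′(U)λ)(x)|, |(G′(U)∇*_Uλ)(x)|,
|(Δ_UG′(U)λ)(x)| ≦ B₀[(Lʲη)², Lʲη, Lʲη, 1]e^{−δ₀d(y,y′)}|λ|"*.

**Why this file (pub-ymgap, node N06 [B9], rows 18 ∕ 19 of the stage-11 certificate; LOCATED-26 road (a)).**  The certificate DISPLAYS `h36 : … → Local342 (opsWalkY x …) 1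
(H x) p.B₀ p.δ₀ U` (rows 18) and `h36A : … → Local342G (𝔬A x) 1 (H x) q.B₀ q.δ₀ U ∧ …` (rows 19, `𝔬A` abstract with the pins `hblkA hblkYA hDcoA hDscoA hLcoA`).  The
two currency bridges `B9Local342OfEBlockInv` (site sector) and `B9Local342GOfEBlockInvB` (bond sector) turn the tree's Cor-3.6 currency — the (3.42) block table of ONE
letter over the invariant test class — into the four entry majorants at the coordinate models.  This file is the last inch, BY NAME and AT THE PINS: (§1) for any
`𝔬 : Ops (geo9K i) B (XSK κ i) (XSK κ i) ι` pinned to the site models with `𝔬.Gsq U □ = GcoS … (O □) U`, the per-cube tables give `Local342 𝔬`; (§2) for any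
`𝔬 : Ops310 (geo9K i) B (XBK κ i) (XBK κ i) ι A` pinned to the bond models with `𝔬.Gsq U □ = GcoK … (O □) U`, they give `Local342G 𝔬`; (§3) the instance at the
record `B9WalkLettersOps.opsWalkY` (every pin `rfl`; its `Gsq U □` is `GcoS` of def-Y's letter `GsqY … (cubeDomY x □)`), so that rows 18's `Local342` conjunct is, by
name, the per-cube table `∀ □, EBlock (kernelFamilySInv x.toKIdx B cfg (GsqY x.toKIdx parS (cubeDomY x □)) par) B₀ δ U`.  The pins form (§1) serves unchanged a record
whose `Gsq` is re-pinned to another site letter (road (a): r05's uncompressed cube-sequence inverse `GpCubeY`, for which the tree HOLDS Cor. 3.6: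
`B9Cor36GpCubeEntriesAtV`, `B9Cor36GpCoverBindersUnitary`).

HONEST SCOPE.  Packaging by name of the two bridges; the (3.42) block tables are HYPOTHESES (`hE`); the section hypotheses `hβs ∕ hβb` (index block = carrier block on the
section) as in the bridges; nothing of [B9] Cor. 3.6 ∕ Thm 3.7 ∕ Thm 3.10 asserted; count-neutral; rows 18 ∕ 19 NOT thereby derived (their (3.42) tables at the pinned
letters remain the displayed analytic content); N06 NOT discharged; nothing continuum ∕ OS ∕ mass gap ∕ Clay.  Cell `pub-ymgap` (D-0062), seat `pub-ymgap-dag-n06-c`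
(gen 22).  Net new unproved facts: 0.  NEW file.
-/

noncomputable section

namespace Literature.MathematicalPhysics.QuantumFieldTheory.Balaban1983to89.B9Local342AtPins

open Node00 (SiteY FBondY IBondY CfgY SiteOpY SiteParY BondOpY BondParY)
open Node00.OpsYLocalInverse (GsqY)
open B6GlobalChartV1 (blkV1)
open B6Geom246MultiLevelBox (blkOf)
open B6Ineq2142KLevelV1 (β)
open B6KLevelCensusIndexV1 (KIdx)
open B6Cover236MultiLevelBlocks (cubes)
open B6RandomWalk (HasMajorant)
open B6RandomWalkHom (HasMajorantHom)
open B9Thm34Ext (toB6)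
open B9FromB6 (EBlock)
open B9GeoNormsKLevelV1 (geo9K)
open B9PinMembersKLevelV1 (MemberY geo9Y)
open B9Thm39ReadingCoords (cR39 coordBound39 basisBound39)
open B9CoReadingCoords (XBK blkBK GcoK DcoK DscoK LcoK)
open B9CoReadingCoordsS (XSK blkSK sIK GcoS DcoS DscoS LcoS)
open B9CubeLettersInvReadings (kernelFamilySInv kernelFamilyBInv)
open B9Local342OfEBlockInv (hasMajorant_GcoS_of_eBlockInv hasMajorantHom_DcoS_GcoS_of_eBlockInv hasMajorantHom_GcoS_DscoS_of_eBlockInv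
  hasMajorantHom_LcoS_GcoS_of_eBlockInv)
open B9Local342GOfEBlockInvB (hasMajorant_GcoK_of_eBlockInvB hasMajorantHom_DcoK_GcoK_of_eBlockInvB hasMajorantHom_GcoK_DscoK_of_eBlockInvB
  hasMajorantHom_LcoK_GcoK_of_eBlockInvB)
open B9Thm37Whole (Ops Local342)
open B9Thm310Whole (Ops310 Local342G)
open B9WalkLettersOps (opsWalkY)
open B9WalkLettersCoordsS (cubeDomY)

/-! ## §0 Transport of block majorants along pin equations -/

section Transport

variable {G : B6.Geometry} {X Y : Type}

/-- a block majorant transported along equalities of the block map and of the operator (the pins of a letter record). [folklore] -/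
private theorem hasMajorant_of_pins {blk blk' : X → G.Site} {T T' : Module.End ℝ (X → ℝ)} {K : G.Site → G.Site → ℝ} (hb : blk = blk') (hT : T = T')
    (h : HasMajorant (g := G) blk' T' K) : HasMajorant (g := G) blk T K := by
  subst hb hT
  exact h

/-- a two-block majorant transported along equalities of the block maps and of the operator. [folklore] -/
private theorem hasMajorantHom_of_pins {blkX blkX' : X → G.Site} {blkY blkY' : Y → G.Site} {T T' : (X → ℝ) →ₗ[ℝ] (Y → ℝ)} {K : G.Site → G.Site → ℝ}
    (hX : blkX = blkX') (hY : blkY = blkY') (hT : T = T') (h : HasMajorantHom (g := G) blkX' blkY' T' K) : HasMajorantHom (g := G) blkX blkY T K := by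
  subst hX hY hT
  exact h

end Transport

variable {d ℓ : ℕ} {hd : 1 ≤ d + 1} {hL : Odd (ℓ + 1) ∧ 1 < ℓ + 1} {b₀ b₁ : ℝ}
variable {𝔸 : Type} [NormedRing 𝔸] [NormedAlgebra ℂ 𝔸] [CompleteSpace 𝔸] [FiniteDimensional ℝ 𝔸]
variable {κ : Type} [Fintype κ]

/-! ## §1 Site sector: `Local342` of a pinned record from the per-cube (3.42) tables -/

section Site

variable (i : KIdx d ℓ hd hL b₀ b₁) [Fintype (geo9K i).Site] (b : Module.Basis κ ℝ 𝔸)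
variable (B : B9.Backgrounds) (cfg : B.Cfg → CfgY 𝔸 i) {ι : Type} (O : ι → SiteOpY 𝔸 i) (par : SiteParY 𝔸 i)
variable {R₀ : ℝ} {H₀ : Prop} {bI : FBondY i → IBondY i} {B₀ δ : ℝ} {U₁ : B.Cfg}

/-- ★★ **`Local342` AT THE PINS (site sector)** — p. 409 «the operators G′_□(U) … satisfy all the inequalities of Theorems 3.1–3.3», read through the bridge: for a letter record
`𝔬` over the site coordinate carrier whose blocks are `blkSK (sIK bI)` and whose fields `Gsq U □ ∕ D U ∕ Dstar U ∕ Lap U` are def-Y's models `GcoS … (O □) U ∕ DcoS ∕ DscoS ∕ LcoS`,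
the per-cube (3.42) block tables `EBlock (kernelFamilySInv i B cfg (O □) par) B₀ δ U` give `Local342 𝔬 R H (c_R·c_b·b_b·B₀) δ U`.
[cite: Balaban1985BackgroundPropagators, Cor. 3.6 p.408 + p.409, (3.42) p.397, (3.87) p.409; Balaban1984PropagatorsII, (2.51) p.232] -/
theorem local342_of_eBlockInv_pins (𝔬 : Ops (geo9K i) B (XSK κ i) (XSK κ i) ι)
    (hblk : 𝔬.blk = blkSK i (sIK i bI)) (hblkY : 𝔬.blkY = blkSK i (sIK i bI)) (hGsq : ∀ j, 𝔬.Gsq U₁ j = GcoS i b B cfg (O j) U₁)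
    (hD : 𝔬.D U₁ = DcoS i b B cfg U₁) (hDs : 𝔬.Dstar U₁ = DscoS i b B cfg U₁) (hLap : 𝔬.Lap U₁ = LcoS i b B cfg U₁)
    (hE : ∀ j, EBlock (kernelFamilySInv i B cfg (O j) par) B₀ δ U₁) (hB₀ : 0 ≤ B₀)
    (hβs : ∀ z : SiteY i, β i.hN i.D i.hk (sIK i bI z) = blkOf i.D.toDomains z) :
    Local342 𝔬 R₀ H₀ (cR39 b * coordBound39 b * basisBound39 b * B₀) δ U₁ := by
  refine ⟨fun j => ?_, fun j => ?_, fun j => ?_, fun j => ?_⟩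
  · exact hasMajorant_of_pins hblk (by rw [hGsq]) (hasMajorant_GcoS_of_eBlockInv i b B cfg (O j) par (R₀ := R₀) (H₀ := H₀) (hE j) hB₀ hβs)
  · exact hasMajorantHom_of_pins hblk hblkY (by rw [hD, hGsq])
      (hasMajorantHom_DcoS_GcoS_of_eBlockInv i b B cfg (O j) par (R₀ := R₀) (H₀ := H₀) (hE j) hB₀ hβs)
  · exact hasMajorantHom_of_pins hblkY hblk (by rw [hDs, hGsq])
      (hasMajorantHom_GcoS_DscoS_of_eBlockInv i b B cfg (O j) par (R₀ := R₀) (H₀ := H₀) (hE j) hB₀ hβs)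
  · exact hasMajorantHom_of_pins hblk hblk (by rw [hLap, hGsq])
      (hasMajorantHom_LcoS_GcoS_of_eBlockInv i b B cfg (O j) par (R₀ := R₀) (H₀ := H₀) (hE j) hB₀ hβs)

end Site

/-! ## §2 Bond sector: `Local342G` of a pinned record from the per-cube (3.42) tables -/

section Bond

variable (i : KIdx d ℓ hd hL b₀ b₁) [Fintype (geo9K i).Site] (b : Module.Basis κ ℝ 𝔸)
variable (B : B9.Backgrounds) (cfg : B.Cfg → CfgY 𝔸 i) {ι A : Type} (O : ι → BondOpY 𝔸 i) (par : BondParY 𝔸 i)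
variable {R₀ : ℝ} {H₀ : Prop} {bI : FBondY i → IBondY i} {B₀ δ : ℝ} {U₁ : B.Cfg}

/-- ★★ **`Local342G` AT THE PINS (bond sector)** — p. 416 with Thm 3.3 p. 399 («G′(U) replaced by G(U) and λ replaced by a function J defined at bonds»), read through the
bridge: for a letter record `𝔬 : Ops310 …` over the bond coordinate carrier whose blocks are `blkBK bI` (the certificate's pins `hblkA hblkYA`) and whose fields
`Gsq U □ ∕ D U ∕ Dstar U ∕ Lap U` are the models `GcoK … (O □) U ∕ DcoK ∕ DscoK ∕ LcoK` (pins `hDcoA hDscoA hLcoA` and the `Gsq` pin), the per-cube (3.42) block tables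
`EBlock (kernelFamilyBInv i B cfg (O □) par) B₀ δ U` give `Local342G 𝔬 R H (c_R·c_b·b_b·B₀) δ U`.
[cite: Balaban1985BackgroundPropagators, Thm 3.10 p.416, Thm 3.3 p.399, Cor. 3.6 p.408, (3.42) p.397; Balaban1984PropagatorsII, (2.51) p.232] -/
theorem local342G_of_eBlockInvB_pins (𝔬 : Ops310 (geo9K i) B (XBK κ i) (XBK κ i) ι A)
    (hblk : 𝔬.blk = blkBK i bI) (hblkY : 𝔬.blkY = blkBK i bI) (hGsq : ∀ j, 𝔬.Gsq U₁ j = GcoK i b B cfg (O j) U₁)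
    (hD : 𝔬.D U₁ = DcoK i b B cfg U₁) (hDs : 𝔬.Dstar U₁ = DscoK i b B cfg U₁) (hLap : 𝔬.Lap U₁ = LcoK i b B cfg U₁)
    (hE : ∀ j, EBlock (kernelFamilyBInv i B cfg (O j) par) B₀ δ U₁) (hB₀ : 0 ≤ B₀)
    (hβb : ∀ x : FBondY i, β i.hN i.D i.hk (bI x) = blkV1 i.hN i.D x) :
    Local342G 𝔬 R₀ H₀ (cR39 b * coordBound39 b * basisBound39 b * B₀) δ U₁ := by
  refine ⟨fun j => ?_, fun j => ?_, fun j => ?_, fun j => ?_⟩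
  · exact hasMajorant_of_pins hblk (by rw [hGsq]) (hasMajorant_GcoK_of_eBlockInvB i b B cfg (O j) par (R₀ := R₀) (H₀ := H₀) (hE j) hB₀ hβb)
  · exact hasMajorantHom_of_pins hblk hblkY (by rw [hD, hGsq])
      (hasMajorantHom_DcoK_GcoK_of_eBlockInvB i b B cfg (O j) par (R₀ := R₀) (H₀ := H₀) (hE j) hB₀ hβb)
  · exact hasMajorantHom_of_pins hblkY hblk (by rw [hDs, hGsq])
      (hasMajorantHom_GcoK_DscoK_of_eBlockInvB i b B cfg (O j) par (R₀ := R₀) (H₀ := H₀) (hE j) hB₀ hβb)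
  · exact hasMajorantHom_of_pins hblk hblk (by rw [hLap, hGsq])
      (hasMajorantHom_LcoK_GcoK_of_eBlockInvB i b B cfg (O j) par (R₀ := R₀) (H₀ := H₀) (hE j) hB₀ hβb)

end Bond

/-! ## §3 The instance at the record `opsWalkY` (rows 18) -/

section Record

variable {Mstar : ℕ} (x : MemberY d ℓ hd hL b₀ b₁ Mstar) [Fintype (geo9Y x).Site] (b : Module.Basis κ ℝ 𝔸)
variable (B : B9.Backgrounds) (cfg : B.Cfg → CfgY 𝔸 x.toKIdx) (parS : SiteParY 𝔸 x.toKIdx) (bI : FBondY x.toKIdx → IBondY x.toKIdx) (par : SiteParY 𝔸 x.toKIdx)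
variable {R₀ : ℝ} {H₀ : Prop} {B₀ δ : ℝ} {U₁ : B.Cfg}

/-- ★★ **rows 18's `Local342` CONJUNCT AT THE RECORD, FROM THE PER-CUBE (3.42) TABLES OF def-Y's LETTER** — at dag-n06-d's record `opsWalkY x b B cfg parS bI` (blocks
`blkSK (sIK bI)`, `Gsq U □ = GcoS … (GsqY … parS (cubeDomY x □)) U`, `D ∕ Dstar ∕ Lap = DcoS ∕ DscoS ∕ LcoS`, all by `rfl`), the tables `EBlock (kernelFamilySInv x.toKIdx B cfg
(GsqY x.toKIdx parS (cubeDomY x □)) par) B₀ δ U` for every cube `□` give `Local342 (opsWalkY x b B cfg parS bI) R H (c_R·c_b·b_b·B₀) δ U` — the shape the certificate's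
`h36` displays (with its `(R, H) = (1, H x)`).  The tables themselves are the analytic content (Cor. 3.6 for the pinned letter) and stay hypotheses.
[cite: Balaban1985BackgroundPropagators, Cor. 3.6 p.408 + p.409, (3.42) p.397, (3.87) p.409; Balaban1984PropagatorsII, (2.37) p.229, (2.51) p.232] -/
theorem local342_opsWalkY_of_eBlockInv
    (hE : ∀ c : ↥(cubes x.toKIdx.D.toDomains), EBlock (kernelFamilySInv x.toKIdx B cfg (GsqY x.toKIdx parS (cubeDomY x c)) par) B₀ δ U₁) (hB₀ : 0 ≤ B₀)
    (hβs : ∀ z : SiteY x.toKIdx, β x.toKIdx.hN x.toKIdx.D x.toKIdx.hk (sIK x.toKIdx bI z) = blkOf x.toKIdx.D.toDomains z) :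
    Local342 (opsWalkY x b B cfg parS bI) R₀ H₀ (cR39 b * coordBound39 b * basisBound39 b * B₀) δ U₁ :=
  letI : Fintype (geo9K x.toKIdx).Site := (inferInstance : Fintype (geo9Y x).Site)
  local342_of_eBlockInv_pins x.toKIdx b B cfg (fun c => GsqY x.toKIdx parS (cubeDomY x c)) par (opsWalkY x b B cfg parS bI)
    rfl rfl (fun _ => rfl) rfl rfl rfl hE hB₀ hβs

end Record

end Literature.MathematicalPhysics.QuantumFieldTheory.Balaban1983to89.B9Local342AtPins
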